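import Literature.Barriers.CriticalPhenomena.WeaklySAWFlowSbarOperator
import Literature.Barriers.CriticalPhenomena.WeaklySAWFlowPerturbation
import HarnessLib

/-!
# [BBS-rg-flow, §3 recast]: the flow map `T` in scaled coordinates and its Lipschitz estimates
# (the quantitative first-derivative content of Lemma 3.3)

Eleventh file of the series formalising [BBS-rg-flow] (Bauerschmidt–Brydges–Slade, AHP 16 (2015),
arXiv:1211.2477), the abstract dynamical-system input of BBS 2015, Theorem 4.1 (via its Theorem 7.2.1),
towards `Literature.Barriers.CriticalPhenomena.WeaklySAWFourDimLogCorrections`; continuation of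
`WeaklySAWFlowSbarOperator.lean` (`S̄ = diag(1, S̄_{𝒱𝒱})`) and `WeaklySAWFlowPerturbation.lean`
((A3), Lipschitz bounds for `ψ_j, ρ_j` on `D_j`, Lemma 1.3).

## The road taken (deviation from the printed proof, documented)
§3.1 of the source obtains the flow `x` of `Φ = (ψ, φ̄ + ρ)` with the boundary conditions of
Theorem 1.4 as the time-1 value of the Banach-space ODE `ẋ = S(t,x)ρ(x)`, `x(0) = x̄` ((3.4)–(3.7)),
which needs the solution operator `S(t,x) = (1 - S̄W)⁻¹S̄` of the linearised equation at every point
(Lemmas 3.5, 4.4, 4.5) and its derivative. Here we take a genuinely shorter road to the same flow: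
in the scaled coordinates `ỹ = (K̃, Ṽ) ∈ ℓ^∞(∏𝒲_j) × ℓ^∞(ℝ³)` of `X^𝗐` around `x̄ = (K̄, V̄)`
(`x_j = x̄_j + (𝗐_{K,j}K̃_j, 𝗐_{g,j}g̃_j, 𝗐_{z,j}z̃_j, 𝗐_{μ,j}μ̃_j)`, `𝗐_K = (a - a_*)χg̊³`), the flow
equations with the boundary conditions are EQUIVALENT to the fixed-point equation `ỹ = Tỹ` for
`Tỹ = (T^K ỹ, S̄_{𝒱𝒱}Ñ(ỹ))`, where `(T^K ỹ)_{j+1} = 𝗐_{K,j+1}⁻¹[ψ_j(x_j) - ψ_j(x̄_j)]` and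
`Ñ_{j+1}(ỹ) = 𝗏_{V,j+1}⁻¹[Q_j(y^V_j) + ρ_j(x_j)]` (`φ̄_j(V̄_j + y) - φ̄_j(V̄_j) = L_jy + Q_j(y)` exactly),
and `T` is a CONTRACTION of the `b`-ball for `𝗁 ≥ 𝗁_*` and `g₀` small: its Lipschitz constants come
from the FIRST derivatives of (A3) only, which in the weighted norms are `‖D_Kψ‖ ≤ κΩ(1+O(g₀)) < 1`,
`‖D_Vψ‖, ‖D_Vρ‖ = O(g₀|log g₀|)`, `‖D_Kρ‖ = O((a-a_*)/𝗁)` ((3.10)) and `‖D²Φ̄⁰‖·b = O(𝗁b·g₀log²g₀)`.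
This file builds `T` and proves exactly these estimates; the fixed point and Theorem 1.4(i) follow
in the next file.

## Contents
* `physV`, `physX` (the physical point of a scaled increment), `baseX` (`x̄_j`), `TK`, `srcN` (`Ñ`),
  `toSeqV`/`toSeqK` (truncation to `ℓ^∞`, making `T` total), `Tmap` (the map `T`, with the
  `𝒱`-solution operator as an argument, to be instantiated with `sbarVP`);
* `physX_mem_flowDomain`: the ball lies over the domains `D_j(g₀, a, h)` (given Lemma 1.3 for `K̄`
  and `a_* + b(a-a_*) ≤ a`, `b ≤ 1`) — "the projection of `x̄ + 𝔹` onto the `j`-th element is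
  contained in `D_j`" (§3.2);
* the small quantities `ϑ = Ω(1-2Bg₀)⁻³` (`stepRatio`), `ε₁ = g₀|log g₀|` (`epsLog`),
  `ε₂ = 2g₀log²(2g₀)` (`epsLogSq`), with `g̊_j|log g̊_j| ≤ 2ε₁`, `g̊_jlog²g̊_j ≤ ε₂` (monotonicity of
  `t|log t|`, `tlog²t`), and the weight-ratio lemmas (R1) `𝗐_{K,j} ≤ ϑ𝗐_{K,j+1}`,
  (R2) `Mχ_{j+1}g̊_{j+1}²𝗐_{g,j} ≤ 4Mε₁·𝗏_{V,j+1}`, (R4) `χ_j𝗐_{g,j}² ≤ 8Ωε₂𝗁·𝗏_{V,j+1}`;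
* the pointwise Lipschitz estimates `norm_stepK_sub_le` (constants `κϑ`, `4Mε₁𝗁/(a-a_*)`),
  `norm_stepN_sub_le` (constants `M(a-a_*)ϑ/𝗁`, `8(2B+14C)Ωε₂𝗁b + 4Mε₁`) and the size at the base
  point `norm_stepN_zero_le` (`‖Ñ(0)‖ ≤ M/𝗁`, (3.9)).

## References
* R. Bauerschmidt, D. C. Brydges, G. Slade, *Structural stability of a dynamical system near a
  non-hyperbolic fixed point*, Ann. Henri Poincaré 16 (2015), arXiv:1211.2477: §3.1 (3.3)–(3.7),
  §3.2 (3.1)–(3.2), Lemma 3.3 (3.9)–(3.11), Lemma 3.5, Lemma 4.4 (proof). [BauerschmidtBrydgesSlade2015Flow]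
-/

noncomputable section

open Filter Topology Set
open scoped BigOperators ENNReal

namespace Literature.Barriers.CriticalPhenomena

namespace CTWSAW

/-! ## The flow map `T` of the contraction argument: scaled coordinates around `x̄ = (K̄, V̄)` -/

open scoped ENNReal

section Embedding

variable {W : ℕ → Type*} [∀ j, NormedAddCommGroup (W j)] [∀ j, NormedSpace ℝ (W j)]

/-- The physical `𝒱`-increment of a scaled one: `(𝗐_{g,j}g̃, 𝗐_{z,j}z̃, 𝗐_{μ,j}μ̃)`.
[cite: BauerschmidtBrydgesSlade2015Flow, §3.2, (3.1)–(3.2)] -/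
def physV (P : QuadFlowParams) (Ω : ℝ) (k : ℕ∞) (g₀ hh : ℝ) (j : ℕ) (v : V3) : V3 :=
  ![P.wG g₀ hh j * v 0, P.wZ g₀ Ω k hh j * v 1, P.wZ g₀ Ω k hh j * v 2]

/-- Coordinates of `physV`. [cite: BauerschmidtBrydgesSlade2015Flow, §3.2, (3.2)] -/
@[simp] theorem physV_apply_zero (P : QuadFlowParams) (Ω : ℝ) (k : ℕ∞) (g₀ hh : ℝ) (j : ℕ) (v : V3) :
    physV P Ω k g₀ hh j v 0 = P.wG g₀ hh j * v 0 := rfl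

/-- Coordinates of `physV`. [cite: BauerschmidtBrydgesSlade2015Flow, §3.2, (3.2)] -/
@[simp] theorem physV_apply_one (P : QuadFlowParams) (Ω : ℝ) (k : ℕ∞) (g₀ hh : ℝ) (j : ℕ) (v : V3) :
    physV P Ω k g₀ hh j v 1 = P.wZ g₀ Ω k hh j * v 1 := rfl

/-- Coordinates of `physV`. [cite: BauerschmidtBrydgesSlade2015Flow, §3.2, (3.2)] -/
@[simp] theorem physV_apply_two (P : QuadFlowParams) (Ω : ℝ) (k : ℕ∞) (g₀ hh : ℝ) (j : ℕ) (v : V3) :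
    physV P Ω k g₀ hh j v 2 = P.wZ g₀ Ω k hh j * v 2 := rfl

/-- `physV` is linear: differences. [cite: BauerschmidtBrydgesSlade2015Flow, §3.2, (3.1)] -/
theorem physV_sub (P : QuadFlowParams) (Ω : ℝ) (k : ℕ∞) (g₀ hh : ℝ) (j : ℕ) (v v' : V3) :
    physV P Ω k g₀ hh j v - physV P Ω k g₀ hh j v' = physV P Ω k g₀ hh j (v - v') := by
  ext i; fin_cases i <;> simp [physV] <;> ring

/-- `physV` is linear: sums. [cite: BauerschmidtBrydgesSlade2015Flow, §3.2, (3.1)] -/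
theorem physV_add (P : QuadFlowParams) (Ω : ℝ) (k : ℕ∞) (g₀ hh : ℝ) (j : ℕ) (v v' : V3) :
    physV P Ω k g₀ hh j v + physV P Ω k g₀ hh j v' = physV P Ω k g₀ hh j (v + v') := by
  ext i; fin_cases i <;> simp [physV] <;> ring

/-- `physV` is linear: scalars. [cite: BauerschmidtBrydgesSlade2015Flow, §3.2, (3.1)] -/
theorem physV_smul (P : QuadFlowParams) (Ω : ℝ) (k : ℕ∞) (g₀ hh : ℝ) (j : ℕ) (a : ℝ) (v : V3) :
    physV P Ω k g₀ hh j (a • v) = a • physV P Ω k g₀ hh j v := by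
  ext i; fin_cases i <;> simp [physV] <;> ring

/-- `physV 0 = 0`. [cite: BauerschmidtBrydgesSlade2015Flow, §3.2, (3.1)] -/
@[simp] theorem physV_zero (P : QuadFlowParams) (Ω : ℝ) (k : ℕ∞) (g₀ hh : ℝ) (j : ℕ) :
    physV P Ω k g₀ hh j 0 = 0 := by
  ext i; fin_cases i <;> simp [physV]

/-- The base flow `x̄_j = (K̄_j, V̄_j)` of `Φ̄ = (ψ, φ̄)`. [cite: BauerschmidtBrydgesSlade2015Flow, §3.1, (3.3) and §3.2] -/
def baseX (P : QuadFlowParams) (ψ : ∀ j, W j × V3 → W (j + 1)) (g₀ : ℝ) (K₀ : W 0) (j : ℕ) : W j × V3 :=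
  (Kbar ψ (P.flow g₀) K₀ j, P.flow g₀ j)

/-- The physical point of a scaled increment: `x_j = x̄_j + (𝗐_{K,j}K̃_j, 𝗐_{V,j}·Ṽ_j)`.
[cite: BauerschmidtBrydgesSlade2015Flow, §3.2 ("x ∈ x̄ + 𝔹")] -/
def physX (P : QuadFlowParams) (ψ : ∀ j, W j × V3 → W (j + 1)) (Ω : ℝ) (k : ℕ∞) (g₀ hh aK : ℝ)
    (K₀ : W 0) (j : ℕ) (y : W j × V3) : W j × V3 :=
  (Kbar ψ (P.flow g₀) K₀ j + P.wK g₀ Ω k aK j • y.1, P.flow g₀ j + physV P Ω k g₀ hh j y.2)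

/-- `physX_j(0) = x̄_j`. [cite: BauerschmidtBrydgesSlade2015Flow, §3.2] -/
@[simp] theorem physX_zero (P : QuadFlowParams) (ψ : ∀ j, W j × V3 → W (j + 1)) (Ω : ℝ) (k : ℕ∞)
    (g₀ hh aK : ℝ) (K₀ : W 0) (j : ℕ) : physX P ψ Ω k g₀ hh aK K₀ j 0 = baseX P ψ g₀ K₀ j := by
  simp [physX, baseX]

/-- The `𝒦`-row of the flow map in scaled coordinates: `(T^K ỹ)₀ = 0` (the initial condition `K₀` is
fixed) and `(T^K ỹ)_{j+1} = 𝗐_{K,j+1}⁻¹[ψ_j(x_j) - ψ_j(x̄_j)]` (so that a fixed point has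
`K_{j+1} = ψ_j(x_j)`, since `K̄_{j+1} = ψ_j(x̄_j)`). [cite: BauerschmidtBrydgesSlade2015Flow, §3.1, (3.3)–(3.4) and (1.4)] -/
def TK (P : QuadFlowParams) (ψ : ∀ j, W j × V3 → W (j + 1)) (Ω : ℝ) (k : ℕ∞) (g₀ hh aK : ℝ)
    (K₀ : W 0) (y : (∀ j, W j) × (ℕ → V3)) : ∀ j, W j
  | 0 => 0
  | j + 1 => (P.wK g₀ Ω k aK (j + 1))⁻¹ •
      (ψ j (physX P ψ Ω k g₀ hh aK K₀ j (y.1 j, y.2 j)) - ψ j (baseX P ψ g₀ K₀ j))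

/-- The scaled source of the `𝒱`-rows: `Ñ₀ = 0`, `Ñ_{j+1} = 𝗏_{V,j+1}⁻¹[Q_j(V̄_j; y^V_j) + ρ_j(x_j)]`,
so that the `𝒱`-equation `V_{j+1} = φ̄_j(V_j) + ρ_j(x_j)` reads `y^V_{j+1} = L_jy^V_j + 𝗏_{j+1}Ñ_{j+1}`.
[cite: BauerschmidtBrydgesSlade2015Flow, (1.5), §3.1 (3.5)–(3.7) and §4.1] -/
def srcN (P : QuadFlowParams) (ψ : ∀ j, W j × V3 → W (j + 1)) (ρ : ∀ j, W j × V3 → V3) (Ω : ℝ) (k : ℕ∞)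
    (g₀ hh aK : ℝ) (K₀ : W 0) (y : (∀ j, W j) × (ℕ → V3)) : ℕ → V3
  | 0 => 0
  | j + 1 => (P.vV g₀ Ω k hh (j + 1))⁻¹ •
      (P.quadRem j (P.flow g₀ j) (physV P Ω k g₀ hh j (y.2 j)) + ρ j (physX P ψ Ω k g₀ hh aK K₀ j (y.1 j, y.2 j)))

/-- `(T^K ỹ)₀ = 0`. [cite: BauerschmidtBrydgesSlade2015Flow, §3.1] -/
@[simp] theorem TK_zero (P : QuadFlowParams) (ψ : ∀ j, W j × V3 → W (j + 1)) (Ω : ℝ) (k : ℕ∞)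
    (g₀ hh aK : ℝ) (K₀ : W 0) (y : (∀ j, W j) × (ℕ → V3)) : TK P ψ Ω k g₀ hh aK K₀ y 0 = 0 := rfl

/-- `(T^K ỹ)_{j+1}`. [cite: BauerschmidtBrydgesSlade2015Flow, §3.1] -/
theorem TK_succ (P : QuadFlowParams) (ψ : ∀ j, W j × V3 → W (j + 1)) (Ω : ℝ) (k : ℕ∞)
    (g₀ hh aK : ℝ) (K₀ : W 0) (y : (∀ j, W j) × (ℕ → V3)) (j : ℕ) :
    TK P ψ Ω k g₀ hh aK K₀ y (j + 1) = (P.wK g₀ Ω k aK (j + 1))⁻¹ •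
      (ψ j (physX P ψ Ω k g₀ hh aK K₀ j (y.1 j, y.2 j)) - ψ j (baseX P ψ g₀ K₀ j)) := rfl

/-- `Ñ₀ = 0`. [cite: BauerschmidtBrydgesSlade2015Flow, §3.3, (3.8)] -/
@[simp] theorem srcN_zero (P : QuadFlowParams) (ψ : ∀ j, W j × V3 → W (j + 1)) (ρ : ∀ j, W j × V3 → V3)
    (Ω : ℝ) (k : ℕ∞) (g₀ hh aK : ℝ) (K₀ : W 0) (y : (∀ j, W j) × (ℕ → V3)) :
    srcN P ψ ρ Ω k g₀ hh aK K₀ y 0 = 0 := rfl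

/-- `Ñ_{j+1}`. [cite: BauerschmidtBrydgesSlade2015Flow, §3.3, (3.8)] -/
theorem srcN_succ (P : QuadFlowParams) (ψ : ∀ j, W j × V3 → W (j + 1)) (ρ : ∀ j, W j × V3 → V3)
    (Ω : ℝ) (k : ℕ∞) (g₀ hh aK : ℝ) (K₀ : W 0) (y : (∀ j, W j) × (ℕ → V3)) (j : ℕ) :
    srcN P ψ ρ Ω k g₀ hh aK K₀ y (j + 1) = (P.vV g₀ Ω k hh (j + 1))⁻¹ •
      (P.quadRem j (P.flow g₀ j) (physV P Ω k g₀ hh j (y.2 j)) +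
        ρ j (physX P ψ Ω k g₀ hh aK K₀ j (y.1 j, y.2 j))) := rfl

open Classical in
/-- Truncation of a sequence to `ℓ^∞` (the identity on bounded sequences, `0` otherwise); used to make the
flow map total. [folklore] -/
def toSeqV (f : ℕ → V3) : SeqV := if hf : Memℓp f ∞ then ⟨f, hf⟩ else 0

open Classical in
/-- Truncation of a sequence to `ℓ^∞(∏𝒲_j)`. [folklore] -/
def toSeqK (f : ∀ j, W j) : SeqK W := if hf : Memℓp f ∞ then ⟨f, hf⟩ else 0

/-- On bounded sequences `toSeqV` is the identity. [folklore] -/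
theorem coe_toSeqV {f : ℕ → V3} (hf : Memℓp f ∞) : (toSeqV f : ℕ → V3) = f := by
  simp [toSeqV, hf]

omit [∀ j, NormedSpace ℝ (W j)] in
/-- On bounded sequences `toSeqK` is the identity. [folklore] -/
theorem coe_toSeqK {f : ∀ j, W j} (hf : Memℓp f ∞) : (toSeqK f : ∀ j, W j) = f := by
  simp [toSeqK, hf]

/-- A uniformly bounded sequence is in `ℓ^∞`. [folklore] -/
theorem memℓp_of_forall_norm_le {E : ℕ → Type*} [∀ j, NormedAddCommGroup (E j)] {f : ∀ j, E j} {M : ℝ}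
    (hf : ∀ j, ‖f j‖ ≤ M) : Memℓp f ∞ :=
  memℓp_infty ⟨M, by rintro _ ⟨j, rfl⟩; exact hf j⟩

/-- **The flow map `T`** on `X = ℓ^∞(∏𝒲_j) × ℓ^∞(ℝ³)` (scaled coordinates around `x̄`):
`Tỹ = (T^K ỹ, S̄_{𝒱𝒱}Ñ(ỹ))` with `S̄_{𝒱𝒱}` the solution operator of the linearised `𝒱`-equations
(argument `S`). Its fixed points in the unit-type ball are exactly the flows of `Φ = (ψ, φ̄ + ρ)` with the
boundary conditions of Theorem 1.4 and the bounds (1.11)–(1.14) (Banach's fixed point theorem replaces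
the continuity-method ODE `ẋ = S(t,x)ρ(x)` of §3.1 of the source, whose integral curves end at the same
flow). [cite: BauerschmidtBrydgesSlade2015Flow, §3.1, (3.4)–(3.7) and Lemma 3.5] -/
def Tmap (P : QuadFlowParams) (ψ : ∀ j, W j × V3 → W (j + 1)) (ρ : ∀ j, W j × V3 → V3) (Ω : ℝ) (k : ℕ∞)
    (g₀ hh aK : ℝ) (K₀ : W 0) (S : SeqV →L[ℝ] SeqV) (y : SeqK W × SeqV) : SeqK W × SeqV :=
  (toSeqK (TK P ψ Ω k g₀ hh aK K₀ ((y.1 : ∀ j, W j), (y.2 : ℕ → V3))),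
    S (toSeqV (srcN P ψ ρ Ω k g₀ hh aK K₀ ((y.1 : ∀ j, W j), (y.2 : ℕ → V3)))))

end Embedding

/-! ### Weight comparisons and the domain condition `x_j ∈ D_j` on the ball -/

namespace CutoffQuadHyp

variable {P : QuadFlowParams} {Ω : ℝ} {k : ℕ∞} {B c : ℝ} {N : ℕ} {C lam g₀ : ℝ}
  (h : CutoffQuadHyp P Ω k B c N C lam g₀)
include h

/-- `𝗐_{z,j} ≤ 𝗐_{g,j}` (`χ_j ≤ 1`). [cite: BauerschmidtBrydgesSlade2015Flow, §3.2, (3.2)] -/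
theorem wZ_le_wG {hh : ℝ} (hh0 : 0 ≤ hh) (j : ℕ) : P.wZ g₀ Ω k hh j ≤ P.wG g₀ hh j := by
  unfold QuadFlowParams.wZ QuadFlowParams.wG
  have h1 := h.weight_le_one j; have := (h.weight_pos j).le
  have hq : 0 ≤ gbar P.β g₀ j ^ 2 * |Real.log (gbar P.β g₀ j)| := by positivity
  calc hh * (cutoffWeight Ω k j * gbar P.β g₀ j ^ 2 * |Real.log (gbar P.β g₀ j)|)
      = hh * (cutoffWeight Ω k j * (gbar P.β g₀ j ^ 2 * |Real.log (gbar P.β g₀ j)|)) := by ring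
    _ ≤ hh * (1 * (gbar P.β g₀ j ^ 2 * |Real.log (gbar P.β g₀ j)|)) := by gcongr
    _ = _ := by ring

/-- `‖(𝗐_{g,j}g̃, 𝗐_{z,j}z̃, 𝗐_{μ,j}μ̃)‖ ≤ 𝗐_{g,j}‖Ṽ‖`. [cite: BauerschmidtBrydgesSlade2015Flow, §3.2, (3.1)–(3.2)] -/
theorem norm_physV_le {hh : ℝ} (hh0 : 0 ≤ hh) (j : ℕ) (v : V3) :
    ‖physV P Ω k g₀ hh j v‖ ≤ P.wG g₀ hh j * ‖v‖ := by
  have hG : 0 ≤ P.wG g₀ hh j := by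
    rcases hh0.eq_or_lt with h0 | h0
    · simp [QuadFlowParams.wG, ← h0]
    · exact (h.wG_pos h0 j).le
  have hZ : 0 ≤ P.wZ g₀ Ω k hh j := by
    rcases hh0.eq_or_lt with h0 | h0
    · simp [QuadFlowParams.wZ, ← h0]
    · exact (h.wZ_pos h0 j).le
  have hZG := h.wZ_le_wG hh0 j
  have hv : ∀ i, |v i| ≤ ‖v‖ := fun i => QuadFlowParams.abs_apply_le_norm v i
  refine norm_V3_le (by positivity) ?_ ?_ ?_
  · rw [physV_apply_zero, abs_mul, abs_of_nonneg hG]; exact mul_le_mul_of_nonneg_left (hv 0) hG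
  · rw [physV_apply_one, abs_mul, abs_of_nonneg hZ]; exact mul_le_mul hZG (hv 1) (abs_nonneg _) hG
  · rw [physV_apply_two, abs_mul, abs_of_nonneg hZ]; exact mul_le_mul hZG (hv 2) (abs_nonneg _) hG

/-- **The ball lies over the domains**: if `‖K̄_j‖ ≤ a_*χ_jg̊_j³` (Lemma 1.3), `‖K̃_j‖ ≤ b`, `‖Ṽ_j‖ ≤ b`,
`b ≤ 1` and `a_* + b(a - a_*) ≤ a`, then `x_j = x̄_j + (𝗐_K K̃_j, 𝗐_V Ṽ_j) ∈ D_j(g₀, a, h)`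
("the projection of `x̄ + 𝔹` onto the `j`-th sequence element is contained in `D_j`", §3.2).
[cite: BauerschmidtBrydgesSlade2015Flow, §3.2 (paragraph after (3.2))] -/
theorem physX_mem_flowDomain {W : ℕ → Type*} [∀ j, NormedAddCommGroup (W j)] [∀ j, NormedSpace ℝ (W j)]
    {ψ : ∀ j, W j × V3 → W (j + 1)} {K₀ : W 0} {hh a aStar b : ℝ} (hh0 : 0 ≤ hh) (hb1 : b ≤ 1)
    (haS : 0 ≤ a - aStar) (hsum : aStar + b * (a - aStar) ≤ a) (j : ℕ)
    (hKbar : ‖Kbar ψ (P.flow g₀) K₀ j‖ ≤ aStar * cutoffWeight Ω k j * gbar P.β g₀ j ^ 3)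
    {y : W j × V3} (hy1 : ‖y.1‖ ≤ b) (hy2 : ‖y.2‖ ≤ b) :
    physX P ψ Ω k g₀ hh (a - aStar) K₀ j y ∈ flowDomain (cutoffWeight Ω k) (P.flow g₀) a hh j := by
  have hw := (h.weight_pos j).le; have hg := (h.gbar_pos j).le; have hw1 := h.weight_le_one j
  have hv : ∀ i, |y.2 i| ≤ b := fun i => (QuadFlowParams.abs_apply_le_norm y.2 i).trans hy2
  have hL : 0 ≤ |Real.log (gbar P.β g₀ j)| := abs_nonneg _
  refine ⟨?_, ?_, ?_, ?_⟩
  · -- `‖K̄_j + 𝗐_{K,j}K̃_j‖ ≤ (a_* + b(a-a_*))χ_jg̊_j³ ≤ aχ_jg̊_j³`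
    simp only [physX, QuadFlowParams.flow_apply_zero]
    calc ‖Kbar ψ (P.flow g₀) K₀ j + P.wK g₀ Ω k (a - aStar) j • y.1‖
        ≤ ‖Kbar ψ (P.flow g₀) K₀ j‖ + ‖P.wK g₀ Ω k (a - aStar) j • y.1‖ := norm_add_le _ _
      _ ≤ aStar * cutoffWeight Ω k j * gbar P.β g₀ j ^ 3 +
            (a - aStar) * (cutoffWeight Ω k j * gbar P.β g₀ j ^ 3) * b := by
          refine add_le_add hKbar ?_
          rw [norm_smul, Real.norm_eq_abs, QuadFlowParams.wK, abs_of_nonneg (by positivity)]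
          exact mul_le_mul_of_nonneg_left hy1 (by positivity)
      _ = (aStar + b * (a - aStar)) * (cutoffWeight Ω k j * gbar P.β g₀ j ^ 3) := by ring
      _ ≤ a * (cutoffWeight Ω k j * gbar P.β g₀ j ^ 3) := mul_le_mul_of_nonneg_right hsum (by positivity)
      _ = a * cutoffWeight Ω k j * gbar P.β g₀ j ^ 3 := by ring
  · have hG0 : 0 ≤ P.wG g₀ hh j := by unfold QuadFlowParams.wG; positivity
    simp only [physX, Pi.add_apply, physV_apply_zero, QuadFlowParams.flow_apply_zero, add_sub_cancel_left]
    rw [abs_mul, abs_of_nonneg hG0, QuadFlowParams.wG]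
    calc hh * (gbar P.β g₀ j ^ 2 * |Real.log (gbar P.β g₀ j)|) * |y.2 0|
        ≤ hh * (gbar P.β g₀ j ^ 2 * |Real.log (gbar P.β g₀ j)|) * 1 := by gcongr; exact (hv 0).trans hb1
      _ = hh * gbar P.β g₀ j ^ 2 * |Real.log (gbar P.β g₀ j)| := by ring
  · have hZ0 : 0 ≤ P.wZ g₀ Ω k hh j := by unfold QuadFlowParams.wZ; positivity
    simp only [physX, Pi.add_apply, physV_apply_one, QuadFlowParams.flow_apply_zero, add_sub_cancel_left]
    rw [abs_mul, abs_of_nonneg hZ0, QuadFlowParams.wZ]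
    calc hh * (cutoffWeight Ω k j * gbar P.β g₀ j ^ 2 * |Real.log (gbar P.β g₀ j)|) * |y.2 1|
        ≤ hh * (cutoffWeight Ω k j * gbar P.β g₀ j ^ 2 * |Real.log (gbar P.β g₀ j)|) * 1 := by
          gcongr; exact (hv 1).trans hb1
      _ = hh * cutoffWeight Ω k j * gbar P.β g₀ j ^ 2 * |Real.log (gbar P.β g₀ j)| := by ring
  · have hZ0 : 0 ≤ P.wZ g₀ Ω k hh j := by unfold QuadFlowParams.wZ; positivity
    simp only [physX, Pi.add_apply, physV_apply_two, QuadFlowParams.flow_apply_zero, add_sub_cancel_left]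
    rw [abs_mul, abs_of_nonneg hZ0, QuadFlowParams.wZ]
    calc hh * (cutoffWeight Ω k j * gbar P.β g₀ j ^ 2 * |Real.log (gbar P.β g₀ j)|) * |y.2 2|
        ≤ hh * (cutoffWeight Ω k j * gbar P.β g₀ j ^ 2 * |Real.log (gbar P.β g₀ j)|) * 1 := by
          gcongr; exact (hv 2).trans hb1
      _ = hh * cutoffWeight Ω k j * gbar P.β g₀ j ^ 2 * |Real.log (gbar P.β g₀ j)| := by ring

/-- `x̄_j ∈ D_j(g₀, a, h)` (the case `ỹ = 0`). [cite: BauerschmidtBrydgesSlade2015Flow, Lemma 1.3 and §3.2] -/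
theorem baseX_mem_flowDomain {W : ℕ → Type*} [∀ j, NormedAddCommGroup (W j)] [∀ j, NormedSpace ℝ (W j)]
    {ψ : ∀ j, W j × V3 → W (j + 1)} {K₀ : W 0} {hh a aStar : ℝ} (hh0 : 0 ≤ hh) (haS : 0 ≤ a - aStar) (j : ℕ)
    (hKbar : ‖Kbar ψ (P.flow g₀) K₀ j‖ ≤ aStar * cutoffWeight Ω k j * gbar P.β g₀ j ^ 3) :
    baseX P ψ g₀ K₀ j ∈ flowDomain (cutoffWeight Ω k) (P.flow g₀) a hh j := by
  have := h.physX_mem_flowDomain (ψ := ψ) (K₀ := K₀) hh0 zero_le_one haS (by linarith) j hKbar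
    (y := (0 : W j × V3)) (by simp) (by simp)
  simpa using this

end CutoffQuadHyp


/-! ## Lipschitz and size estimates for `T^K` and `Ñ` on the ball (the quantitative content of
Lemma 3.3, first derivatives, in scaled coordinates) -/

/-- `√(e⁻²) = e⁻¹`. [folklore] -/
theorem sqrt_exp_neg_two : Real.sqrt (Real.exp (-2)) = Real.exp (-1) := by
  have : Real.exp (-2) = Real.exp (-1) ^ 2 := by
    rw [← Real.exp_nat_mul]; norm_num
  rw [this, Real.sqrt_sq (Real.exp_pos _).le]

/-- `t ↦ t log²t` is non-decreasing on `(0, e⁻²]` (via `t log²t = (2√t|log √t|)²` and the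
monotonicity of `u|log u|` on `(0, e⁻¹]`). [folklore] -/
theorem mul_log_sq_le_mul_log_sq {s t : ℝ} (hs : 0 < s) (hst : s ≤ t) (ht : t ≤ Real.exp (-2)) :
    s * Real.log s ^ 2 ≤ t * Real.log t ^ 2 := by
  have ht0 : 0 < t := lt_of_lt_of_le hs hst
  have key : ∀ {u : ℝ}, 0 < u → u * Real.log u ^ 2 = (2 * (Real.sqrt u * |Real.log (Real.sqrt u)|)) ^ 2 := by
    intro u hu
    have hsq : Real.sqrt u ^ 2 = u := Real.sq_sqrt hu.le
    have hlog : Real.log (Real.sqrt u) = Real.log u / 2 := by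
      rw [Real.sqrt_eq_rpow, Real.log_rpow hu]; ring
    rw [hlog, mul_pow, mul_pow, sq_abs, hsq]
    ring
  have hse : Real.sqrt s ≤ Real.sqrt t := Real.sqrt_le_sqrt hst
  have hte : Real.sqrt t ≤ Real.exp (-1) := by
    rw [← sqrt_exp_neg_two]; exact Real.sqrt_le_sqrt ht
  have hm := mul_abs_log_le_mul_abs_log (Real.sqrt_pos.2 hs) hse hte
  rw [key hs, key ht0]
  have h0 : 0 ≤ 2 * (Real.sqrt s * |Real.log (Real.sqrt s)|) := by positivity
  exact pow_le_pow_left₀ h0 (by linarith) 2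

/-- The one-step weight ratio bound `ϑ = Ω(1 - 2Bg₀)⁻³` (`= Ω(1 + O(g₀))`). [cite: BauerschmidtBrydgesSlade2015Flow, Lemma 1.3 (proof) and (3.10)] -/
def stepRatio (Ω B g₀ : ℝ) : ℝ := Ω * ((1 - 2 * B * g₀)⁻¹) ^ 3

/-- `ε₁(g₀) = g₀|log g₀|` (bounds `½ sup_j g̊_j|log g̊_j|`). [cite: BauerschmidtBrydgesSlade2015Flow, Lemma 3.3, (3.10) ("O(g̊₀|log g̊₀|)")] -/
def epsLog (g₀ : ℝ) : ℝ := g₀ * |Real.log g₀|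

/-- `ε₂(g₀) = 2g₀ log²(2g₀)` (bounds `sup_j g̊_j log²g̊_j`). [cite: BauerschmidtBrydgesSlade2015Flow, Lemma 3.3, (3.11)] -/
def epsLogSq (g₀ : ℝ) : ℝ := 2 * g₀ * Real.log (2 * g₀) ^ 2

namespace CutoffQuadHyp

variable {P : QuadFlowParams} {Ω : ℝ} {k : ℕ∞} {B c : ℝ} {N : ℕ} {C lam g₀ : ℝ}
  (h : CutoffQuadHyp P Ω k B c N C lam g₀)
include h

/-- `ϑ ≥ 0`. [cite: BauerschmidtBrydgesSlade2015Flow, Lemma 1.3] -/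
theorem stepRatio_nonneg : 0 ≤ stepRatio Ω B g₀ := by
  have := h.toCutoffGbarHyp.half_le_one_sub_two_mul; have := h.one_lt
  unfold stepRatio
  have : 0 ≤ (1 - 2 * B * g₀)⁻¹ := inv_nonneg.2 (by linarith)
  positivity

/-- `g̊_j|log g̊_j| ≤ 2ε₁(g₀)`. [cite: BauerschmidtBrydgesSlade2015Flow, Lemma 2.1(i) and Lemma 3.3 (3.10)] -/
theorem gbar_mul_log_le_epsLog (hsmall : 4 * g₀ ≤ Real.exp (-1)) (j : ℕ) :
    gbar P.β g₀ j * |Real.log (gbar P.β g₀ j)| ≤ 2 * epsLog g₀ := by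
  simpa [epsLog] using h.toCutoffGbarHyp.gbar_mul_abs_log_le (Nat.zero_le j) hsmall

/-- `g̊_j log²g̊_j ≤ ε₂(g₀)` for `2g₀ ≤ e⁻²`. [cite: BauerschmidtBrydgesSlade2015Flow, Lemma 2.1(i) and Lemma 3.3 (3.11)] -/
theorem gbar_mul_log_sq_le_epsLogSq (hsmall2 : 2 * g₀ ≤ Real.exp (-2)) (j : ℕ) :
    gbar P.β g₀ j * Real.log (gbar P.β g₀ j) ^ 2 ≤ epsLogSq g₀ :=
  mul_log_sq_le_mul_log_sq (h.gbar_pos j) (h.gbar_le_two_mul_init j) hsmall2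

/-- `ε₁ ≥ 0`. [folklore] -/
theorem epsLog_nonneg : 0 ≤ epsLog g₀ := by
  unfold epsLog; have := h.g₀_pos; positivity

/-- `ε₂ ≥ 0`. [folklore] -/
theorem epsLogSq_nonneg : 0 ≤ epsLogSq g₀ := by
  unfold epsLogSq; have := h.g₀_pos; positivity

/-- (R1) `𝗐_{K,j} ≤ ϑ𝗐_{K,j+1}` for `a - a_* ≥ 0`. [cite: BauerschmidtBrydgesSlade2015Flow, (3.10) ("κΩ(1+O(g̊₀))")] -/
theorem wK_le_stepRatio_mul {aK : ℝ} (haK : 0 ≤ aK) (j : ℕ) :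
    P.wK g₀ Ω k aK j ≤ stepRatio Ω B g₀ * P.wK g₀ Ω k aK (j + 1) := by
  have := h.toCutoffGbarHyp.weight_cube_le_mul_succ j
  unfold QuadFlowParams.wK stepRatio
  calc aK * (cutoffWeight Ω k j * gbar P.β g₀ j ^ 3)
      ≤ aK * (Ω * ((1 - 2 * B * g₀)⁻¹) ^ 3 * (cutoffWeight Ω k (j + 1) * gbar P.β g₀ (j + 1) ^ 3)) :=
        mul_le_mul_of_nonneg_left this haK
    _ = _ := by ring

/-- (R2) `Mχ_{j+1}g̊_{j+1}²·𝗐_{g,j} ≤ 4Mε₁(g₀)·𝗁χ_{j+1}g̊_{j+1}³` (uses `g̊_j ≤ 2g̊_{j+1}` and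
`g̊_j|log g̊_j| ≤ 2ε₁`). [cite: BauerschmidtBrydgesSlade2015Flow, Lemma 3.3, (3.10) (the bounds O(g̊₀|log g̊₀|))] -/
theorem chi_gsq_wG_le {M hh : ℝ} (hM : 0 ≤ M) (hh0 : 0 ≤ hh) (hsmall : 4 * g₀ ≤ Real.exp (-1)) (j : ℕ) :
    M * cutoffWeight Ω k (j + 1) * gbar P.β g₀ (j + 1) ^ 2 * P.wG g₀ hh j ≤
      4 * M * epsLog g₀ * (hh * (cutoffWeight Ω k (j + 1) * gbar P.β g₀ (j + 1) ^ 3)) := by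
  have hgl := h.gbar_mul_log_le_epsLog hsmall j
  have hg2 : gbar P.β g₀ j ≤ 2 * gbar P.β g₀ (j + 1) := by linarith [(h.gbar_succ_mem j).1]
  have hw := (h.weight_pos (j + 1)).le; have hg := (h.gbar_pos j).le; have hg' := (h.gbar_pos (j + 1)).le
  have hε := h.epsLog_nonneg
  unfold QuadFlowParams.wG
  calc M * cutoffWeight Ω k (j + 1) * gbar P.β g₀ (j + 1) ^ 2 * (hh * (gbar P.β g₀ j ^ 2 * |Real.log (gbar P.β g₀ j)|))
      = M * hh * cutoffWeight Ω k (j + 1) * gbar P.β g₀ (j + 1) ^ 2 *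
          (gbar P.β g₀ j * (gbar P.β g₀ j * |Real.log (gbar P.β g₀ j)|)) := by ring
    _ ≤ M * hh * cutoffWeight Ω k (j + 1) * gbar P.β g₀ (j + 1) ^ 2 *
          ((2 * gbar P.β g₀ (j + 1)) * (2 * epsLog g₀)) := by gcongr
    _ = _ := by ring

/-- (R4) the quadratic remainder ratio: `χ_j𝗐_{g,j}² ≤ 8Ωε₂(g₀)𝗁 · 𝗁χ_{j+1}g̊_{j+1}³` (uses `χ_j ≤ Ωχ_{j+1}`,
`g̊_j ≤ 2g̊_{j+1}`, `g̊_jlog²g̊_j ≤ ε₂`). [cite: BauerschmidtBrydgesSlade2015Flow, Lemma 3.3, (3.11) and Lemma 4.4 (proof)] -/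
theorem chi_wG_sq_le {hh : ℝ} (hsmall2 : 2 * g₀ ≤ Real.exp (-2)) (j : ℕ) :
    cutoffWeight Ω k j * P.wG g₀ hh j ^ 2 ≤
      8 * Ω * epsLogSq g₀ * hh * (hh * (cutoffWeight Ω k (j + 1) * gbar P.β g₀ (j + 1) ^ 3)) := by
  have hgl := h.gbar_mul_log_sq_le_epsLogSq hsmall2 j
  have hg2 : gbar P.β g₀ j ≤ 2 * gbar P.β g₀ (j + 1) := by linarith [(h.gbar_succ_mem j).1]
  have hχ := cutoffWeight_le_mul_succ h.one_le k j
  have hw := (h.weight_pos (j + 1)).le; have hw0 := (h.weight_pos j).le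
  have hg := (h.gbar_pos j).le; have hg' := (h.gbar_pos (j + 1)).le
  have hε := h.epsLogSq_nonneg; have hΩ : 0 ≤ Ω := by linarith [h.one_lt]
  have hL : |Real.log (gbar P.β g₀ j)| ^ 2 = Real.log (gbar P.β g₀ j) ^ 2 := sq_abs _
  unfold QuadFlowParams.wG
  calc cutoffWeight Ω k j * (hh * (gbar P.β g₀ j ^ 2 * |Real.log (gbar P.β g₀ j)|)) ^ 2
      = hh ^ 2 * cutoffWeight Ω k j * gbar P.β g₀ j ^ 3 * (gbar P.β g₀ j * Real.log (gbar P.β g₀ j) ^ 2) := by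
        rw [← hL]; ring
    _ ≤ hh ^ 2 * (Ω * cutoffWeight Ω k (j + 1)) * (2 * gbar P.β g₀ (j + 1)) ^ 3 * epsLogSq g₀ := by gcongr
    _ = _ := by ring

/-- The coefficient bound `M_j = 2(|β_j| + |θ_j| + |ζ_j| + Σ|υ_j|) ≤ (2B + 14C)χ_j`.
[cite: BauerschmidtBrydgesSlade2015Flow, Assumptions (A1)–(A2) and Lemma 4.4 (proof: "coefficients bounded by O(χ_j)")] -/
theorem coefSum_le (j : ℕ) :
    2 * |P.β j| + 2 * |P.θ j| + 2 * |P.ζ j| + 2 * |P.υgg j| + 2 * |P.υgz j| + 2 * |P.υgμ j| +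
        2 * |P.υzz j| + 2 * |P.υzμ j| ≤ (2 * B + 14 * C) * cutoffWeight Ω k j := by
  have := h.abs_le j; have := h.theta_le j; have := h.zeta_le j; have := h.υgg_le j; have := h.υgz_le j
  have := h.υgμ_le j; have := h.υzz_le j; have := h.υzμ_le j
  linarith

end CutoffQuadHyp


/-! ### Pointwise Lipschitz estimates of the `𝒦`-step and of the scaled source `Ñ` -/

section StepEstimates

variable {W : ℕ → Type*} [∀ j, NormedAddCommGroup (W j)] [∀ j, NormedSpace ℝ (W j)]

/-- Differences of physical points of scaled increments. [cite: BauerschmidtBrydgesSlade2015Flow, §3.2, (3.1)] -/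
theorem physX_sub_physX (P : QuadFlowParams) (ψ : ∀ j, W j × V3 → W (j + 1)) (Ω : ℝ) (k : ℕ∞)
    (g₀ hh aK : ℝ) (K₀ : W 0) (j : ℕ) (y y' : W j × V3) :
    (physX P ψ Ω k g₀ hh aK K₀ j y).1 - (physX P ψ Ω k g₀ hh aK K₀ j y').1 = P.wK g₀ Ω k aK j • (y.1 - y'.1) ∧
      (physX P ψ Ω k g₀ hh aK K₀ j y).2 - (physX P ψ Ω k g₀ hh aK K₀ j y').2 =
        physV P Ω k g₀ hh j (y.2 - y'.2) := by
  constructor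
  · simp only [physX, smul_sub]; abel
  · simp only [physX, ← physV_sub]; abel

namespace CutoffQuadHyp

variable {P : QuadFlowParams} {Ω : ℝ} {k : ℕ∞} {B c : ℝ} {N : ℕ} {C lam g₀ : ℝ}
  (h : CutoffQuadHyp P Ω k B c N C lam g₀)
include h

/-- `𝗐_{K,j} ≤ (a_Kϑ/𝗁)𝗏_{V,j+1}`. [cite: BauerschmidtBrydgesSlade2015Flow, Lemma 3.3, (3.10) (‖D_Kρ‖ ≤ O(1))] -/
theorem wK_le_vV_succ {aK hh : ℝ} (haK : 0 ≤ aK) (hh0 : 0 < hh) (j : ℕ) :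
    P.wK g₀ Ω k aK j ≤ aK * stepRatio Ω B g₀ / hh * P.vV g₀ Ω k hh (j + 1) := by
  have := h.toCutoffGbarHyp.weight_cube_le_mul_succ j
  unfold QuadFlowParams.wK QuadFlowParams.vV stepRatio
  calc aK * (cutoffWeight Ω k j * gbar P.β g₀ j ^ 3)
      ≤ aK * (Ω * ((1 - 2 * B * g₀)⁻¹) ^ 3 * (cutoffWeight Ω k (j + 1) * gbar P.β g₀ (j + 1) ^ 3)) :=
        mul_le_mul_of_nonneg_left this haK
    _ = _ := by field_simp

variable {ψ : ∀ j, W j × V3 → W (j + 1)} {ρ : ∀ j, W j × V3 → V3} {a hh κ R M : ℝ} {K₀ : W 0}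

/-- **Lipschitz estimate of the `𝒦`-step** `y ↦ 𝗐_{K,j+1}⁻¹[ψ_j(x_j(y)) - ψ_j(x̄_j)]` over `D_j`:
constants `κϑ` in `K̃` (`ϑ = Ω(1+O(g₀))`, cf. `‖D_Kψ‖ ≤ κΩ(1+O(g̊₀))` in (3.10)) and
`4Mε₁(g₀)𝗁/(a-a_*)` in `Ṽ` (cf. `‖D_Vψ‖ ≤ O(g̊₀|log g̊₀|)`).
[cite: BauerschmidtBrydgesSlade2015Flow, Lemma 3.3, (3.10)] -/
theorem norm_stepK_sub_le (hA : HypA3 (cutoffWeight Ω k) ψ ρ (P.flow g₀) a hh κ Ω R M)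
    (hsmall : 4 * g₀ ≤ Real.exp (-1)) (hh0 : 0 < hh) {aK : ℝ} (haK : 0 < aK) (j : ℕ) {y y' : W j × V3}
    (hy : physX P ψ Ω k g₀ hh aK K₀ j y ∈ flowDomain (cutoffWeight Ω k) (P.flow g₀) a hh j)
    (hy' : physX P ψ Ω k g₀ hh aK K₀ j y' ∈ flowDomain (cutoffWeight Ω k) (P.flow g₀) a hh j) :
    ‖(P.wK g₀ Ω k aK (j + 1))⁻¹ • (ψ j (physX P ψ Ω k g₀ hh aK K₀ j y) - ψ j (baseX P ψ g₀ K₀ j)) -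
        (P.wK g₀ Ω k aK (j + 1))⁻¹ • (ψ j (physX P ψ Ω k g₀ hh aK K₀ j y') - ψ j (baseX P ψ g₀ K₀ j))‖ ≤
      κ * stepRatio Ω B g₀ * ‖y.1 - y'.1‖ + 4 * M * epsLog g₀ * hh / aK * ‖y.2 - y'.2‖ := by
  have hχ : ∀ j, 0 ≤ cutoffWeight Ω k j := fun j => (h.weight_pos j).le
  have hw1 : 0 < P.wK g₀ Ω k aK (j + 1) := h.wK_pos haK (j + 1)
  have hw0 : 0 ≤ P.wK g₀ Ω k aK j := (h.wK_pos haK j).le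
  obtain ⟨e1, e2⟩ := physX_sub_physX P ψ Ω k g₀ hh aK K₀ j y y'
  have hL := hA.norm_ψ_sub_ψ_le hχ j hy hy'
  rw [e1, e2, QuadFlowParams.flow_apply_zero, norm_smul, Real.norm_eq_abs, abs_of_nonneg hw0] at hL
  have hV := h.norm_physV_le hh0.le j (y.2 - y'.2)
  rw [← smul_sub, sub_sub_sub_cancel_right, norm_smul, Real.norm_eq_abs, abs_of_pos (inv_pos.2 hw1),
    inv_mul_le_iff₀ hw1]
  have hM := hA.M_pos.le; have hκ := hA.κ_pos.le
  have hd1 := norm_nonneg (y.1 - y'.1); have hd2 := norm_nonneg (y.2 - y'.2)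
  have t1 : κ * (P.wK g₀ Ω k aK j * ‖y.1 - y'.1‖) ≤
      P.wK g₀ Ω k aK (j + 1) * (κ * stepRatio Ω B g₀ * ‖y.1 - y'.1‖) := by
    have := h.wK_le_stepRatio_mul haK.le j
    calc κ * (P.wK g₀ Ω k aK j * ‖y.1 - y'.1‖) ≤ κ * (stepRatio Ω B g₀ * P.wK g₀ Ω k aK (j + 1) * ‖y.1 - y'.1‖) := by
          gcongr
      _ = _ := by ring
  have t2 : M * cutoffWeight Ω k (j + 1) * gbar P.β g₀ (j + 1) ^ 2 * ‖physV P Ω k g₀ hh j (y.2 - y'.2)‖ ≤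
      P.wK g₀ Ω k aK (j + 1) * (4 * M * epsLog g₀ * hh / aK * ‖y.2 - y'.2‖) := by
    have hR2 := h.chi_gsq_wG_le hM hh0.le hsmall j
    have hw := (h.weight_pos (j + 1)).le; have hg := (h.gbar_pos (j + 1)).le
    calc M * cutoffWeight Ω k (j + 1) * gbar P.β g₀ (j + 1) ^ 2 * ‖physV P Ω k g₀ hh j (y.2 - y'.2)‖
        ≤ M * cutoffWeight Ω k (j + 1) * gbar P.β g₀ (j + 1) ^ 2 * (P.wG g₀ hh j * ‖y.2 - y'.2‖) := by gcongr
      _ = (M * cutoffWeight Ω k (j + 1) * gbar P.β g₀ (j + 1) ^ 2 * P.wG g₀ hh j) * ‖y.2 - y'.2‖ := by ring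
      _ ≤ (4 * M * epsLog g₀ * (hh * (cutoffWeight Ω k (j + 1) * gbar P.β g₀ (j + 1) ^ 3))) * ‖y.2 - y'.2‖ :=
          mul_le_mul_of_nonneg_right hR2 hd2
      _ = P.wK g₀ Ω k aK (j + 1) * (4 * M * epsLog g₀ * hh / aK * ‖y.2 - y'.2‖) := by
          unfold QuadFlowParams.wK; field_simp
  calc ‖ψ j (physX P ψ Ω k g₀ hh aK K₀ j y) - ψ j (physX P ψ Ω k g₀ hh aK K₀ j y')‖
      ≤ κ * (P.wK g₀ Ω k aK j * ‖y.1 - y'.1‖) +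
          M * cutoffWeight Ω k (j + 1) * gbar P.β g₀ (j + 1) ^ 2 * ‖physV P Ω k g₀ hh j (y.2 - y'.2)‖ := hL
    _ ≤ _ := by rw [mul_add]; exact add_le_add t1 t2

/-- **Lipschitz estimate of the scaled source** `Ñ_{j+1}(y) = 𝗏_{V,j+1}⁻¹[Q_j(𝗐_V·Ṽ_j) + ρ_j(x_j(y))]` over
`D_j ∩ {‖Ṽ‖ ≤ b}`: constants `Ma_Kϑ/𝗁` in `K̃` (cf. `‖D_Kρ‖ ≤ O(1)`) and
`8(2B+14C)Ωε₂(g₀)𝗁b + 4Mε₁(g₀)` in `Ṽ` (cf. `‖D_Vρ‖ ≤ O(g̊₀|log g̊₀|)`, `‖D²Φ̄⁰‖ ≤ C`).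
[cite: BauerschmidtBrydgesSlade2015Flow, Lemma 3.3, (3.10)–(3.11), and Lemma 4.4 (proof)] -/
theorem norm_stepN_sub_le (hA : HypA3 (cutoffWeight Ω k) ψ ρ (P.flow g₀) a hh κ Ω R M)
    (hsmall : 4 * g₀ ≤ Real.exp (-1)) (hsmall2 : 2 * g₀ ≤ Real.exp (-2)) (hh0 : 0 < hh) {aK : ℝ} (haK : 0 ≤ aK)
    {b : ℝ} (hb : 0 ≤ b) (j : ℕ) {y y' : W j × V3}
    (hy : physX P ψ Ω k g₀ hh aK K₀ j y ∈ flowDomain (cutoffWeight Ω k) (P.flow g₀) a hh j)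
    (hy' : physX P ψ Ω k g₀ hh aK K₀ j y' ∈ flowDomain (cutoffWeight Ω k) (P.flow g₀) a hh j)
    (hyb : ‖y.2‖ ≤ b) (hyb' : ‖y'.2‖ ≤ b) :
    ‖(P.vV g₀ Ω k hh (j + 1))⁻¹ • (P.quadRem j (P.flow g₀ j) (physV P Ω k g₀ hh j y.2) +
          ρ j (physX P ψ Ω k g₀ hh aK K₀ j y)) -
        (P.vV g₀ Ω k hh (j + 1))⁻¹ • (P.quadRem j (P.flow g₀ j) (physV P Ω k g₀ hh j y'.2) +
          ρ j (physX P ψ Ω k g₀ hh aK K₀ j y'))‖ ≤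
      M * aK * stepRatio Ω B g₀ / hh * ‖y.1 - y'.1‖ +
        (8 * (2 * B + 14 * C) * Ω * epsLogSq g₀ * hh * b + 4 * M * epsLog g₀) * ‖y.2 - y'.2‖ := by
  have hχ : ∀ j, 0 ≤ cutoffWeight Ω k j := fun j => (h.weight_pos j).le
  have hv1 : 0 < P.vV g₀ Ω k hh (j + 1) := h.vV_pos hh0 (j + 1)
  have hw0 : 0 ≤ P.wK g₀ Ω k aK j := by unfold QuadFlowParams.wK; have := hχ j; have := (h.gbar_pos j).le; positivity
  have hG0 : 0 ≤ P.wG g₀ hh j := (h.wG_pos hh0 j).le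
  obtain ⟨e1, e2⟩ := physX_sub_physX P ψ Ω k g₀ hh aK K₀ j y y'
  have hM := hA.M_pos.le
  have hd1 := norm_nonneg (y.1 - y'.1); have hd2 := norm_nonneg (y.2 - y'.2)
  -- the `ρ`-part
  have hρ := hA.norm_ρ_sub_ρ_le hχ j hy hy'
  rw [e1, e2, QuadFlowParams.flow_apply_zero, norm_smul, Real.norm_eq_abs, abs_of_nonneg hw0] at hρ
  have hV := h.norm_physV_le hh0.le j (y.2 - y'.2)
  -- the quadratic part
  have hQ := P.norm_quadRem_sub_quadRem_le j (P.flow g₀ j) (physV P Ω k g₀ hh j y.2) (physV P Ω k g₀ hh j y'.2)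
  have hmid : ‖(1 / 2 : ℝ) • (physV P Ω k g₀ hh j y.2 + physV P Ω k g₀ hh j y'.2)‖ ≤ P.wG g₀ hh j * b := by
    rw [norm_smul, Real.norm_eq_abs, abs_of_pos (by norm_num : (0:ℝ) < 1 / 2)]
    have h1 := (h.norm_physV_le hh0.le j y.2).trans (mul_le_mul_of_nonneg_left hyb hG0)
    have h2 := (h.norm_physV_le hh0.le j y'.2).trans (mul_le_mul_of_nonneg_left hyb' hG0)
    calc 1 / 2 * ‖physV P Ω k g₀ hh j y.2 + physV P Ω k g₀ hh j y'.2‖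
        ≤ 1 / 2 * (‖physV P Ω k g₀ hh j y.2‖ + ‖physV P Ω k g₀ hh j y'.2‖) := by gcongr; exact norm_add_le _ _
      _ ≤ 1 / 2 * (P.wG g₀ hh j * b + P.wG g₀ hh j * b) := by gcongr
      _ = _ := by ring
  rw [physV_sub] at hQ
  have hcoef := h.coefSum_le j
  have hBC : 0 ≤ 2 * B + 14 * C := by have := h.B_nonneg; have := h.C_nonneg; positivity
  have hχj := hχ j
  have hQ' : ‖P.quadRem j (P.flow g₀ j) (physV P Ω k g₀ hh j y.2) -
      P.quadRem j (P.flow g₀ j) (physV P Ω k g₀ hh j y'.2)‖ ≤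
      (2 * B + 14 * C) * b * (cutoffWeight Ω k j * P.wG g₀ hh j ^ 2) * ‖y.2 - y'.2‖ := by
    refine hQ.trans ?_
    have hc0 : 0 ≤ 2 * |P.β j| + 2 * |P.θ j| + 2 * |P.ζ j| + 2 * |P.υgg j| + 2 * |P.υgz j| + 2 * |P.υgμ j| +
        2 * |P.υzz j| + 2 * |P.υzμ j| := by positivity
    calc (2 * |P.β j| + 2 * |P.θ j| + 2 * |P.ζ j| + 2 * |P.υgg j| + 2 * |P.υgz j| + 2 * |P.υgμ j| +
          2 * |P.υzz j| + 2 * |P.υzμ j|) * ‖(1 / 2 : ℝ) • (physV P Ω k g₀ hh j y.2 + physV P Ω k g₀ hh j y'.2)‖ *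
          ‖physV P Ω k g₀ hh j (y.2 - y'.2)‖
        ≤ ((2 * B + 14 * C) * cutoffWeight Ω k j) * (P.wG g₀ hh j * b) * (P.wG g₀ hh j * ‖y.2 - y'.2‖) := by
          gcongr
      _ = _ := by ring
  -- divide by `𝗏_{V,j+1}`
  rw [← smul_sub, norm_smul, Real.norm_eq_abs, abs_of_pos (inv_pos.2 hv1), inv_mul_le_iff₀ hv1]
  have hsplit : P.quadRem j (P.flow g₀ j) (physV P Ω k g₀ hh j y.2) + ρ j (physX P ψ Ω k g₀ hh aK K₀ j y) -
      (P.quadRem j (P.flow g₀ j) (physV P Ω k g₀ hh j y'.2) + ρ j (physX P ψ Ω k g₀ hh aK K₀ j y')) =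
      (P.quadRem j (P.flow g₀ j) (physV P Ω k g₀ hh j y.2) - P.quadRem j (P.flow g₀ j) (physV P Ω k g₀ hh j y'.2)) +
        (ρ j (physX P ψ Ω k g₀ hh aK K₀ j y) - ρ j (physX P ψ Ω k g₀ hh aK K₀ j y')) := by abel
  rw [hsplit]
  have hΩ : 0 ≤ Ω := by linarith [h.one_lt]
  have hε1 := h.epsLog_nonneg; have hε2 := h.epsLogSq_nonneg; have hϑ := h.stepRatio_nonneg
  -- three pieces, each bounded by `𝗏_{V,j+1} × (constant × increment)`
  have p1 : (2 * B + 14 * C) * b * (cutoffWeight Ω k j * P.wG g₀ hh j ^ 2) * ‖y.2 - y'.2‖ ≤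
      P.vV g₀ Ω k hh (j + 1) * (8 * (2 * B + 14 * C) * Ω * epsLogSq g₀ * hh * b * ‖y.2 - y'.2‖) := by
    have hR4 := h.chi_wG_sq_le (hh := hh) hsmall2 j
    calc (2 * B + 14 * C) * b * (cutoffWeight Ω k j * P.wG g₀ hh j ^ 2) * ‖y.2 - y'.2‖
        ≤ (2 * B + 14 * C) * b * (8 * Ω * epsLogSq g₀ * hh * (hh * (cutoffWeight Ω k (j + 1) * gbar P.β g₀ (j + 1) ^ 3))) *
            ‖y.2 - y'.2‖ := by gcongr
      _ = _ := by unfold QuadFlowParams.vV; ring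
  have p2 : M * (P.wK g₀ Ω k aK j * ‖y.1 - y'.1‖) ≤
      P.vV g₀ Ω k hh (j + 1) * (M * aK * stepRatio Ω B g₀ / hh * ‖y.1 - y'.1‖) := by
    have := h.wK_le_vV_succ haK hh0 j
    calc M * (P.wK g₀ Ω k aK j * ‖y.1 - y'.1‖)
        ≤ M * (aK * stepRatio Ω B g₀ / hh * P.vV g₀ Ω k hh (j + 1) * ‖y.1 - y'.1‖) := by gcongr
      _ = _ := by ring
  have p3 : M * cutoffWeight Ω k (j + 1) * gbar P.β g₀ (j + 1) ^ 2 * ‖physV P Ω k g₀ hh j (y.2 - y'.2)‖ ≤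
      P.vV g₀ Ω k hh (j + 1) * (4 * M * epsLog g₀ * ‖y.2 - y'.2‖) := by
    have hR2 := h.chi_gsq_wG_le hM hh0.le hsmall j
    have hw := (h.weight_pos (j + 1)).le; have hg := (h.gbar_pos (j + 1)).le
    calc M * cutoffWeight Ω k (j + 1) * gbar P.β g₀ (j + 1) ^ 2 * ‖physV P Ω k g₀ hh j (y.2 - y'.2)‖
        ≤ M * cutoffWeight Ω k (j + 1) * gbar P.β g₀ (j + 1) ^ 2 * (P.wG g₀ hh j * ‖y.2 - y'.2‖) := by gcongr
      _ = (M * cutoffWeight Ω k (j + 1) * gbar P.β g₀ (j + 1) ^ 2 * P.wG g₀ hh j) * ‖y.2 - y'.2‖ := by ring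
      _ ≤ (4 * M * epsLog g₀ * (hh * (cutoffWeight Ω k (j + 1) * gbar P.β g₀ (j + 1) ^ 3))) * ‖y.2 - y'.2‖ :=
          mul_le_mul_of_nonneg_right hR2 hd2
      _ = _ := by unfold QuadFlowParams.vV; ring
  calc ‖(P.quadRem j (P.flow g₀ j) (physV P Ω k g₀ hh j y.2) - P.quadRem j (P.flow g₀ j) (physV P Ω k g₀ hh j y'.2)) +
        (ρ j (physX P ψ Ω k g₀ hh aK K₀ j y) - ρ j (physX P ψ Ω k g₀ hh aK K₀ j y'))‖
      ≤ ‖P.quadRem j (P.flow g₀ j) (physV P Ω k g₀ hh j y.2) - P.quadRem j (P.flow g₀ j) (physV P Ω k g₀ hh j y'.2)‖ +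
        ‖ρ j (physX P ψ Ω k g₀ hh aK K₀ j y) - ρ j (physX P ψ Ω k g₀ hh aK K₀ j y')‖ := norm_add_le _ _
    _ ≤ (2 * B + 14 * C) * b * (cutoffWeight Ω k j * P.wG g₀ hh j ^ 2) * ‖y.2 - y'.2‖ +
        (M * (P.wK g₀ Ω k aK j * ‖y.1 - y'.1‖) +
          M * cutoffWeight Ω k (j + 1) * gbar P.β g₀ (j + 1) ^ 2 * ‖physV P Ω k g₀ hh j (y.2 - y'.2)‖) :=
        add_le_add hQ' hρ
    _ ≤ P.vV g₀ Ω k hh (j + 1) * (8 * (2 * B + 14 * C) * Ω * epsLogSq g₀ * hh * b * ‖y.2 - y'.2‖) +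
        (P.vV g₀ Ω k hh (j + 1) * (M * aK * stepRatio Ω B g₀ / hh * ‖y.1 - y'.1‖) +
          P.vV g₀ Ω k hh (j + 1) * (4 * M * epsLog g₀ * ‖y.2 - y'.2‖)) := add_le_add p1 (add_le_add p2 p3)
    _ = _ := by ring

/-- The scaled source at the base point: `‖Ñ_{j+1}(0)‖ = 𝗏_{V,j+1}⁻¹‖ρ_j(x̄_j)‖ ≤ M/𝗁` ((3.9):
`‖ρ(x)‖_{X^𝗏} ≤ M𝗁⁻¹`). [cite: BauerschmidtBrydgesSlade2015Flow, Lemma 3.3, (3.9)] -/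
theorem norm_stepN_zero_le (hA : HypA3 (cutoffWeight Ω k) ψ ρ (P.flow g₀) a hh κ Ω R M) (hh0 : 0 < hh) {aK : ℝ}
    (j : ℕ) (hx : baseX P ψ g₀ K₀ j ∈ flowDomain (cutoffWeight Ω k) (P.flow g₀) a hh j) :
    ‖(P.vV g₀ Ω k hh (j + 1))⁻¹ • (P.quadRem j (P.flow g₀ j) (physV P Ω k g₀ hh j (0 : W j × V3).2) +
        ρ j (physX P ψ Ω k g₀ hh aK K₀ j 0))‖ ≤ M / hh := by
  have hv1 : 0 < P.vV g₀ Ω k hh (j + 1) := h.vV_pos hh0 (j + 1)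
  have hρ := hA.ρ_le j _ hx
  rw [QuadFlowParams.flow_apply_zero] at hρ
  simp only [Prod.snd_zero, physV_zero, QuadFlowParams.quadRem_zero, zero_add, physX_zero]
  rw [norm_smul, Real.norm_eq_abs, abs_of_pos (inv_pos.2 hv1), inv_mul_le_iff₀ hv1]
  calc ‖ρ j (baseX P ψ g₀ K₀ j)‖ ≤ M * cutoffWeight Ω k (j + 1) * gbar P.β g₀ (j + 1) ^ 3 := hρ
    _ = P.vV g₀ Ω k hh (j + 1) * (M / hh) := by unfold QuadFlowParams.vV; field_simp

end CutoffQuadHyp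

end StepEstimates


end CTWSAW

end Literature.Barriers.CriticalPhenomena
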